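import Literature.Barriers.HodgeConjecture.KaehlerCoherentSheavesProofs
import Literature.Barriers.HodgeConjecture.KaehlerCounterexamplesJTorus
import Literature.Barriers.HodgeConjecture.KaehlerCoherentSheavesRationalFormsProofs
import Literature.Geometry.Kaehler.ComplexTorusWeilEigen
import HarnessLib

/-!
# Voisin's Weil torus, clause (c): a non-zero rational `(2,2)`-class from de Rham's theorem

Third file of the discharge programme of the barrier fact
`Literature.Barriers.HodgeConjecture.Voisin2002_weilTorus_hodgeClassWithoutSubvarieties`
(`KaehlerCoherentSheaves.lean`; programme in `KaehlerCoherentSheavesProofs.lean`). For the complex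
torus `X = ℂ⁴/Φ(ℤ^ι)` of a **lattice of Weil type** — a period isomorphism `Φ : ℝ^ι ≃ ℂ⁴` with an
integer matrix `A` such that `Φ ∘ A = J ∘ Φ`, `J = diag(i, i, -i, -i)` (`Weil.J`; Voisin, IMRN 2002
no. 20, §3: "a `ℤ[I]`-action on `Γ = ℤ⁸`" with `dim W_i = dim W_{-i} = 2`) — and for ANY natural
complex de Rham comparison family `e` (de Rham's theorem `exists_complexDeRhamIsoFamily (Fin 4 → ℂ)`
provides one), we PROVE clause (c) of `VoisinWeilTorusWitness`:

* `exists_isRationalClass_weilClass`: **`H⁴(X; ℂ)` contains a non-zero RATIONAL class of type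
  `(2, 2)`** (`IsRationalClass`, `IsOfTypeOnManifold 4 2 2`) — Voisin's "`⋀⁴_K Γ_ℚ` is made of
  Hodge classes" (§3 p. 5; Prop. 3: `Hdg⁴(X) = ⋀⁴_K Γ_ℚ` for general `X`).

## Proof (no Künneth formula, no computation of `H⁴(X; ℤ)`)

Let `T = (1 + I)^*` be the pull-back along the isogeny `x ↦ x + Ix` of `X` (the real-smooth map
`ComplexTorus.mapMatrix Φ Φ (1 + A)`, with analytic representation `S = 1 + J`,
`realRep_one_add_of_weilLattice`). On `H⁴_dR(X; ℂ) = Alt⁴_ℝ(ℂ⁴; ℂ)` (invariant forms,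
Lange–Birkenhake Prop. 1.1.20) `T` is `γ ↦ γ ∘ S`, so (file `ComplexTorusWeilEigen`)
`T⁴ = 256` (`S⁴ = -4`), every `-4`-eigenclass of `T` lies in `H^{2,2}`
(`Weil.isConstOfType_two_two_of_apply_S`), and `Q = (T - 4)(T² + 16)` does not vanish
(`Q[Ω] = -256 [Ω]`, `Ω = dz₀ ∧ dz₁ ∧ dz̄₂ ∧ dz̄₃`). Naturality of `e` transports all three
statements to singular cohomology `H⁴(X; ℂ)` (as in `KaehlerCounterexamplesProofs`: eigenclasses of
type `(p,q)`, `IsOfTypeOnManifold.of_map_eq_smul`). Rational classes span `H⁴(X; ℂ)` over `ℂ`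
(universal coefficients, tree `span_isRationalClass_eq_top`, the homology of the compact
`8`-manifold `X` being finitely generated, Hatcher App. A), so `Q y ≠ 0` for some rational `y`;
then `cls = Q y` is rational (pull-backs preserve rational classes), non-zero, and
`(T + 4) cls = (T⁴ - 256) y = 0`, so `cls` is of type `(2, 2)`. In Voisin's terms: `Q` is (up to
the factor `-256`) the projector of `H⁴(X, ℚ) = ⋀⁴ Γ_ℚ` onto the Weil classes `⋀⁴_K Γ_ℚ`, the
`-4 = (1 ± i)⁴`-eigenspace of `1 + I`.

No definition and no named fact is introduced.

## References

* C. Voisin, IMRN 2002 no. 20, 1057–1075 (arXiv:math/0112247), §3 (pp. 5–6), Prop. 3.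
  [Voisin2002KaehlerCounterexample]
* B. van Geemen, in LNM 1594 (1994), Thm. 4.11, §5 (Weil classes). [vanGeemen1994HodgeAV]
* A. Hatcher, *Algebraic Topology* (2002), §3.1 Thm. 3.2, p. 198; App. A Cor. A.8–A.9.
  [HatcherAT2002]
-/

noncomputable section

open scoped Manifold ContDiff Topology ComplexConjugate

namespace Literature.Barriers.HodgeConjecture

open Literature.AlgebraicGeometry.HodgeTheory Literature.AlgebraicTopology.SingularHomology
  Literature.NumberTheory.Transcendental Literature.Geometry.Kaehler singularCochainComplex

/-! ### The de Rham side on the torus of a lattice of Weil type -/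

section Torus

/-! A **lattice of Weil type** (Voisin: a `ℤ[I]`-action on `Γ = ℤ⁸` for which `I` acts on
`Γ_ℝ = V` with `dim V_i = dim V_{-i} = 2`), in the tree's coordinates: a period isomorphism
`Φ : ℝ^ι ≃ ℂ⁴` intertwining an integer matrix `A` with `J = diag(i, i, -i, -i)` — the hypothesis
`hA` below — so that `mapMatrix A` is the automorphism `I` of `X = ℂ⁴/Φ(ℤ^ι)` and
`mapMatrix (1 + A)` the isogeny `1 + I`. -/

variable {ι : Type} [Fintype ι] [DecidableEq ι] {Φ : (ι → ℝ) ≃L[ℝ] (Fin 4 → ℂ)}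
  {A : Matrix ι ι ℤ} (hA : ∀ x : ι → ℝ, Φ ((A.map (Int.cast : ℤ → ℝ)).mulVec x) = Weil.J (Φ x))
include hA

/-- For a lattice of Weil type the analytic representation of `mapMatrix (1 + A)` is `S = 1 + J`.
[cite: Voisin2002KaehlerCounterexample, §3 p. 5] -/
theorem realRep_one_add_of_weilLattice :
    ComplexTorus.realRep Φ Φ (1 + A) = Weil.S.restrictScalars ℝ := by
  ext1 z
  obtain ⟨x, rfl⟩ := Φ.surjective z
  have hmap : (1 + A).map (Int.cast : ℤ → ℝ) = 1 + A.map (Int.cast : ℤ → ℝ) := by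
    ext i j
    by_cases h : i = j <;> simp [h]
  rw [ComplexTorus.realRep_apply, hmap, Matrix.add_mulVec, Matrix.one_mulVec, map_add, hA x]
  rfl

/-- **`(1 + I)^*[constForm c] = [constForm (c ∘ S)]`** on `H^k_dR(X; ℂ)` for a lattice of Weil type.
[cite: Voisin2002KaehlerCounterexample, §3 pp. 5–6] -/
theorem cmap_cconstClass_of_weilLattice {k : ℕ} (c : (Fin 4 → ℂ) [⋀^Fin k]→L[ℝ] ℂ) :
    complexDeRhamCohomology.map (Fin 4 → ℂ)
        (ComplexTorus.contMDiff_real_mapMatrix (Φ := Φ) (Φ' := Φ) (n := ∞) (1 + A)) k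
        (ComplexTorus.cconstClass Φ c) =
      ComplexTorus.cconstClass Φ (c.compContinuousLinearMap (Weil.S.restrictScalars ℝ)) := by
  rw [cmap_cconstClass_mapMatrix_self, realRep_one_add_of_weilLattice hA]

/-- **`((1 + I)^*)⁴ = 256` on `H⁴_dR(X; ℂ)`** for a lattice of Weil type (`S⁴ = -4`,
`Weil.compContinuousLinearMap_S_four`). [cite: Voisin2002KaehlerCounterexample, §3 pp. 5–6] -/
theorem cmap_cmap_cmap_cmap_of_weilLattice
    (x : complexDeRhamCohomology (Fin 4 → ℂ) (ComplexTorus Φ) 4) :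
    complexDeRhamCohomology.map (Fin 4 → ℂ)
        (ComplexTorus.contMDiff_real_mapMatrix (Φ := Φ) (Φ' := Φ) (n := ∞) (1 + A)) 4
      (complexDeRhamCohomology.map (Fin 4 → ℂ)
        (ComplexTorus.contMDiff_real_mapMatrix (Φ := Φ) (Φ' := Φ) (n := ∞) (1 + A)) 4
      (complexDeRhamCohomology.map (Fin 4 → ℂ)
        (ComplexTorus.contMDiff_real_mapMatrix (Φ := Φ) (Φ' := Φ) (n := ∞) (1 + A)) 4
      (complexDeRhamCohomology.map (Fin 4 → ℂ)
        (ComplexTorus.contMDiff_real_mapMatrix (Φ := Φ) (Φ' := Φ) (n := ∞) (1 + A)) 4 x))) =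
      (256 : ℂ) • x := by
  obtain ⟨c, rfl⟩ : ∃ c, x = ComplexTorus.cconstClass Φ c :=
    ⟨(ComplexTorus.cconstClassEquiv Φ).symm x, by
      rw [← ComplexTorus.cconstClassEquiv_apply, LinearEquiv.apply_symm_apply]⟩
  rw [cmap_cconstClass_of_weilLattice hA, cmap_cconstClass_of_weilLattice hA,
    cmap_cconstClass_of_weilLattice hA, cmap_cconstClass_of_weilLattice hA,
    Weil.compContinuousLinearMap_S_four, map_smul]

/-- **The `-4`-eigenclasses of `(1 + I)^*` in `H⁴_dR(X; ℂ)` are of type `(2, 2)`** for a lattice of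
Weil type (`Weil.isConstOfType_two_two_of_compContinuousLinearMap_S` and
`ComplexTorus.cconstClass_mem_hodgePQ`): Voisin's "`⋀⁴_K Γ_ℚ` … is contained in the subspace
`H^{2,2}(X)`". [cite: Voisin2002KaehlerCounterexample, §3 pp. 5–6] -/
theorem mem_hodgePQ_of_cmap_eq_of_weilLattice
    (x : complexDeRhamCohomology (Fin 4 → ℂ) (ComplexTorus Φ) 4)
    (hx : complexDeRhamCohomology.map (Fin 4 → ℂ)
        (ComplexTorus.contMDiff_real_mapMatrix (Φ := Φ) (Φ' := Φ) (n := ∞) (1 + A)) 4 x =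
        (-4 : ℂ) • x) :
    x ∈ hodgePQ (Fin 4 → ℂ) (ComplexTorus Φ) 4 2 2 := by
  obtain ⟨c, rfl⟩ : ∃ c, x = ComplexTorus.cconstClass Φ c :=
    ⟨(ComplexTorus.cconstClassEquiv Φ).symm x, by
      rw [← ComplexTorus.cconstClassEquiv_apply, LinearEquiv.apply_symm_apply]⟩
  rw [cmap_cconstClass_of_weilLattice hA, ← map_smul] at hx
  have hc : c.compContinuousLinearMap (Weil.S.restrictScalars ℝ) = (-4 : ℂ) • c :=
    (ComplexTorus.cconstClassEquiv Φ).injective (by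
      rwa [ComplexTorus.cconstClassEquiv_apply, ComplexTorus.cconstClassEquiv_apply])
  exact ComplexTorus.cconstClass_mem_hodgePQ Φ
    (Weil.isConstOfType_two_two_of_compContinuousLinearMap_S c hc)

/-- **`Q = (T - 4)(T² + 16)` does not vanish on `H⁴_dR(X; ℂ)`**, `T = (1 + I)^*`: on the class of the
Weil form, `T[Ω] = -4[Ω]`, so `Q[Ω] = ((-4)³ - 4(-4)² + 16(-4) - 64)[Ω] = -256 [Ω] ≠ 0`.
[cite: Voisin2002KaehlerCounterexample, §3 pp. 5–6] -/
theorem exists_cmapQ_ne_zero_of_weilLattice :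
    ∃ x : complexDeRhamCohomology (Fin 4 → ℂ) (ComplexTorus Φ) 4,
      complexDeRhamCohomology.map (Fin 4 → ℂ)
          (ComplexTorus.contMDiff_real_mapMatrix (Φ := Φ) (Φ' := Φ) (n := ∞) (1 + A)) 4
        (complexDeRhamCohomology.map (Fin 4 → ℂ)
          (ComplexTorus.contMDiff_real_mapMatrix (Φ := Φ) (Φ' := Φ) (n := ∞) (1 + A)) 4
        (complexDeRhamCohomology.map (Fin 4 → ℂ)
          (ComplexTorus.contMDiff_real_mapMatrix (Φ := Φ) (Φ' := Φ) (n := ∞) (1 + A)) 4 x))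
      - (4 : ℂ) • complexDeRhamCohomology.map (Fin 4 → ℂ)
          (ComplexTorus.contMDiff_real_mapMatrix (Φ := Φ) (Φ' := Φ) (n := ∞) (1 + A)) 4
        (complexDeRhamCohomology.map (Fin 4 → ℂ)
          (ComplexTorus.contMDiff_real_mapMatrix (Φ := Φ) (Φ' := Φ) (n := ∞) (1 + A)) 4 x)
      + (16 : ℂ) • complexDeRhamCohomology.map (Fin 4 → ℂ)
          (ComplexTorus.contMDiff_real_mapMatrix (Φ := Φ) (Φ' := Φ) (n := ∞) (1 + A)) 4 x
      - (64 : ℂ) • x ≠ 0 := by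
  refine ⟨ComplexTorus.cconstClass Φ Weil.Omega, fun h ↦ Weil.cconstClass_Omega_ne_zero Φ ?_⟩
  have hT : complexDeRhamCohomology.map (Fin 4 → ℂ)
      (ComplexTorus.contMDiff_real_mapMatrix (Φ := Φ) (Φ' := Φ) (n := ∞) (1 + A)) 4
      (ComplexTorus.cconstClass Φ Weil.Omega) = (-4 : ℂ) • ComplexTorus.cconstClass Φ Weil.Omega := by
    rw [cmap_cconstClass_of_weilLattice hA, Weil.Omega_compContinuousLinearMap_S, map_smul]
  simp only [hT, map_smul, smul_smul] at h
  have h' : (-256 : ℂ) • ComplexTorus.cconstClass Φ (k := 4) Weil.Omega = 0 := by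
    rw [← h]
    module
  simpa using h'

end Torus

/-! ### The singular side: transport along a natural comparison family, and the span trick -/

section Singular

variable {ι : Type} [Fintype ι]

/-- **The singular homology of a complex `4`-torus is finitely generated** over any Noetherian
coefficient ring (a compact Hausdorff manifold charted on `ℂ⁴ ≃ ℝ⁸`; Hatcher (2002), App. A
Cor. A.8–A.9, tree `finite_singularHomology_of_compact_chartedSpace`).
[cite: HatcherAT2002, App. A Cor. A.8 and A.9 p. 527] -/
theorem finite_singularHomology_complexTorus₄ (R : Type) [CommRing R] [IsNoetherianRing R]
    (Φ : (ι → ℝ) ≃L[ℝ] (Fin 4 → ℂ)) (k : ℕ) :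
    Module.Finite R (singularHomology R R (ComplexTorus Φ) k) := by
  let eC : (Fin 4 → ℂ) ≃ₜ EuclideanSpace ℝ (Fin 8) :=
    (ContinuousLinearEquiv.ofFinrankEq (𝕜 := ℝ) (by
      rw [Module.finrank_pi_fintype, finrank_euclideanSpace_fin]
      simp [Complex.finrank_real_complex])).toHomeomorph
  letI : ChartedSpace (EuclideanSpace ℝ (Fin 8)) (ComplexTorus Φ) :=
    { atlas := Set.range fun P : ComplexTorus Φ ↦ (chartAt (Fin 4 → ℂ) P).transHomeomorph eC
      chartAt := fun P ↦ (chartAt (Fin 4 → ℂ) P).transHomeomorph eC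
      mem_chart_source := fun P ↦ by
        rw [OpenPartialHomeomorph.transHomeomorph_source]; exact mem_chart_source _ P
      chart_mem_atlas := fun P ↦ ⟨P, rfl⟩ }
  exact finite_singularHomology_of_compact_chartedSpace R R (d := 8) k

variable [DecidableEq ι] {Φ : (ι → ℝ) ≃L[ℝ] (Fin 4 → ℂ)} {A : Matrix ι ι ℤ}
  (hA : ∀ x : ι → ℝ, Φ ((A.map (Int.cast : ℤ → ℝ)).mulVec x) = Weil.J (Φ x))
  {e : ComplexDeRhamIsoFamily (Fin 4 → ℂ)} (he : e.IsNatural)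
include hA he

/-- **Clause (c) of Voisin's witness, from de Rham's theorem.** For the torus `X = ℂ⁴/Φ(ℤ^ι)` of a
lattice of Weil type and any natural complex de Rham comparison family `e`, there is a non-zero
rational class of type `(2, 2)` in `H⁴(X; ℂ)` — an element of Voisin's `⋀⁴_K Γ_ℚ ⊂ H^{2,2}(X)`,
obtained as `Q y`, `Q = (T - 4)(T² + 16)`, `T = (1 + I)^*`, for a rational `y` with `Q y ≠ 0`
(rational classes span `H⁴(X; ℂ)`; `(T + 4) Q = T⁴ - 256 = 0`).
[cite: Voisin2002KaehlerCounterexample, §3 pp. 5–6 and Prop. 3] -/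
theorem exists_isRationalClass_weilClass :
    ∃ cls : singularCohomology ℂ ℂ (ComplexTorus Φ) 4,
      IsRationalClass cls ∧ cls ≠ 0 ∧ IsOfTypeOnManifold (E := Fin 4 → ℂ) 4 2 2 cls := by
  have hF : ContMDiff 𝓘(ℝ, Fin 4 → ℂ) 𝓘(ℝ, Fin 4 → ℂ) ∞ (ComplexTorus.mapMatrix Φ Φ (1 + A)) :=
    ComplexTorus.contMDiff_real_mapMatrix (1 + A)
  set f : C(ComplexTorus Φ, ComplexTorus Φ) := ⟨_, hF.continuous⟩ with hf
  -- the pull-back `T = (1 + I)^*` on `H⁴(X; ℂ)` as a linear map, and `Q = T³ - 4T² + 16T - 64`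
  set T : singularCohomology ℂ ℂ (ComplexTorus Φ) 4 →ₗ[ℂ] singularCohomology ℂ ℂ (ComplexTorus Φ) 4 :=
    (singularCohomology.map ℂ ℂ f 4).hom with hT
  have hTapply : ∀ c, T c = singularCohomology.map ℂ ℂ f 4 c := fun c ↦ rfl
  -- naturality: `T (e x) = e (T_dR x)`
  have hnat : ∀ x : complexDeRhamCohomology (Fin 4 → ℂ) (ComplexTorus Φ) 4,
      T (e _ 4 x) = e _ 4 (complexDeRhamCohomology.map (Fin 4 → ℂ) hF 4 x) := fun x ↦ by
    rw [hTapply, he _ _ _ hF 4 x]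
  set Q : singularCohomology ℂ ℂ (ComplexTorus Φ) 4 →ₗ[ℂ] singularCohomology ℂ ℂ (ComplexTorus Φ) 4 :=
    T ∘ₗ T ∘ₗ T - (4 : ℂ) • (T ∘ₗ T) + (16 : ℂ) • T - (64 : ℂ) • LinearMap.id with hQ
  have hQapply : ∀ c, Q c = T (T (T c)) - (4 : ℂ) • T (T c) + (16 : ℂ) • T c - (64 : ℂ) • c :=
    fun c ↦ rfl
  -- (S1) `T⁴ = 256`
  have hT4 : ∀ c, T (T (T (T c))) = (256 : ℂ) • c := fun c ↦ by
    obtain ⟨x, rfl⟩ := (e _ 4).surjective c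
    rw [hnat, hnat, hnat, hnat, cmap_cmap_cmap_cmap_of_weilLattice hA, map_smul]
  -- (S3) `Q ≠ 0`
  have hQne : Q ≠ 0 := fun hQ0 ↦ by
    obtain ⟨x, hx⟩ := exists_cmapQ_ne_zero_of_weilLattice (Φ := Φ) hA
    apply hx
    apply (e _ 4).injective
    have h0 : Q (e _ 4 x) = 0 := by rw [hQ0]; rfl
    rw [hQapply, hnat, hnat, hnat] at h0
    rw [map_sub, map_add, map_sub, map_smul, map_smul, map_smul, map_zero]
    exact h0
  -- the span trick: some rational `y` has `Q y ≠ 0`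
  haveI := finite_singularHomology_complexTorus₄ ℚ Φ 4
  have hy : ∃ y : singularCohomology ℂ ℂ (ComplexTorus Φ) 4, IsRationalClass y ∧ Q y ≠ 0 := by
    by_contra hne
    push Not at hne
    exact hQne (LinearMap.ext_on (span_isRationalClass_eq_top 4) fun y hy ↦ by
      rw [LinearMap.zero_apply]; exact hne y hy)
  obtain ⟨y, hyr, hyQ⟩ := hy
  refine ⟨Q y, ?_, hyQ, ?_⟩
  · -- rationality: pull-backs, sums and rational multiples of rational classes are rational
    have hTr : ∀ c, IsRationalClass c → IsRationalClass (T c) := fun c hc ↦ by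
      rw [hTapply]; exact hc.map f
    have h1 : IsRationalClass (T (T (T y))) := hTr _ (hTr _ (hTr _ hyr))
    have h2 : IsRationalClass (((-4 : ℚ) : ℂ) • T (T y)) := (hTr _ (hTr _ hyr)).smul (-4)
    have h3 : IsRationalClass (((16 : ℚ) : ℂ) • T y) := (hTr _ hyr).smul 16
    have h4 : IsRationalClass (((-64 : ℚ) : ℂ) • y) := hyr.smul (-64)
    have h := ((h1.add h2).add h3).add h4
    rw [hQapply]
    convert h using 1
    push_cast
    module
  · -- type `(2,2)`: `cls` is a `-4`-eigenclass of `T`, and those are of type `(2,2)`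
    refine IsOfTypeOnManifold.of_map_eq_smul he hF (-4)
      (fun x hx ↦ mem_hodgePQ_of_cmap_eq_of_weilLattice hA x hx) ?_
    change T (Q y) = (-4 : ℂ) • Q y
    rw [hQapply, map_sub, map_add, map_sub, map_smul, map_smul, map_smul, hT4]
    module

end Singular

end Literature.Barriers.HodgeConjecture

end
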